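/-
Copyright (c) 2026 the pub-hodgecm-mathlib formalisation cell (harness21).  Prover seat hodgecm-mathlib-K2Liu-p05 (g5), Track B «K2-LIT»,
#184♮ = hLiu418 = `stmt-HodgeConjecture-24832`; #42S payer road, organ S2 (archimedean spanning), S2-asm FILE 3-b step 3 (σ15 datum PACKAGED as ★ `IsArchDatum`;
RULING M-158g road (γ): «datum = Hermite span (σ15)»; LEAD F0P6-plan (g14) BATCH #22∕#23: FILE 3 = K2Liu-p05).
-/
import Summits.HodgeConjecture.HodgeConjecture.Theorems.K2LiuArchHermiteDatumStability      -- ★ FILE 3-b step 2 `exists_mem_span_omega_tensorEmb_placeSec`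
import Summits.HodgeConjecture.HodgeConjecture.Theorems.K2LiuArchSWSpanningDefs            -- ★ S2-D part 2 `IsArchDatum`
import HarnessLib

/-!
# Crux `HLiu418`, #42S organ S2, S2-asm FILE 3-b step 3: THE HERMITE SPAN `V_D` IS AN ARCH DATUM —
# `IsArchDatum 𝒦 sB (span {follandHermite frameD γ : |γ| ≤ D})` for every `𝒦` whose arch compact part is generated by one-place frame compacts (σ15, road (γ))

Cell `hodgecm-mathlib`, crux item hLiu418 = `stmt-HodgeConjecture-24832`; squad K2 ∕ K2Liu; LEAD F0P6-plan (g14); prover K2Liu-p05 (g5).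
THEOREMS ONLY (no `def`, no instance, no notation, no named-fact hypothesis, no `sorry`); lane `--supports stmt-HodgeConjecture-24832 --as helper`.

WHY.  ★ S2-D part 2's `IsArchDatum 𝒦 sB V` (σ15) = «`V` finite-dimensional, and for every `ainf` with `archToAdelic ainf ∈ 𝒦.K` and every `a ∈ V` some `a′ ∈ V` has
`ω(sB(ainf ⊗ 1)) E(a ⊗ f) = E(a′ ⊗ f)` for all finite vectors `f`».  ★ FILE 3-b step 2 proves the clause for the GENERATORS: `ainf = placeSec_𝔻 σ h` with the one-place
Fock hypothesis `hFock σ h`, and `a = follandHermite frameD β` a Hermite vector of degree `≤ D`.  This file packages it: for the Hermite span `V_D` and every `𝒦` whose arch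
elements lie in the submonoid generated by such one-place elements (hypothesis `hK` — for the standard `𝒦` of socket #42S: `K_∞ = ∏_σ U(2) × U(2)` in the frame, each factor
inside `hFock` by ★ `K2LiuArchWeilFockFiniteDatum.weilDatum_κ_mem_fockLe`), **`isArchDatum_hermiteSpan : IsArchDatum 𝒦 sB V_D`** — finite-dimensionality (finitely many
multi-indices of degree `≤ D` on a finite index type), linear extension over the span (`Submodule.span_induction`; `E`, `ω` linear), and induction over the generated
submonoid (`Submonoid.closure_induction`; `archToAdelic`, `tensorEmb`, `sB`, `ω` multiplicative).
References: [Folland1989] §1.7, Prop. (4.39); [Howe1989] §3 (K-finite = polynomial × Gaussian); [HarrisKudlaSweet1996] §1 (1.15)–(1.17); [KonnoKonno2007] §3.3.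
HONEST LABEL.  Count-neutral helper: `HC_CM` is proved only modulo the 7 printed citations (2 remaining named inputs: hLiu418 = `stmt-HodgeConjecture-24832`,
h413 = `stmt-HodgeConjecture-24833`) until rung 0 closes.
-/

set_option autoImplicit false
set_option linter.dupNamespace false -- the mandated namespace repeats `HodgeConjecture.HodgeConjecture`
set_option synthInstance.maxSize 512 -- `DecidableEq` of the nested block index (as ★∕📤 `K2LiuWeilSeesawRelabel`)

noncomputable section

open scoped Classical Matrix TensorProduct Kronecker SchwartzMap
open NumberField NumberField.InfinitePlace NumberField.mixedEmbedding IsDedekindDomain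
open Literature.Analysis.SegalBargmann Literature.RepresentationTheory.HeisenbergGroup
open Literature.NumberTheory.Automorphic Literature.NumberTheory.Automorphic.UnitaryGroup Literature.NumberTheory.GaloisRepresentations
open Literature.NumberTheory.Weil1964 Literature.NumberTheory.Weil1964.MpS Literature.NumberTheory.Weil1964.UnitaryWeil
open Literature.RepresentationTheory.HarrisKudlaSweet1996
open Literature.RepresentationTheory.KonnoKonno2007 Literature.RepresentationTheory.KonnoKonno2007.RealDualPair
open Literature.NumberTheory.GelbartRogawski1991 Literature.NumberTheory.GelbartRogawski1991.GRConstruction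
open Literature.NumberTheory.GelbartRogawski1991.UnitaryDualPair
open Literature.NumberTheory.GelbartRogawski1991.UnitaryDualPair.LocalSplitting
open Literature.NumberTheory.K2Lit.SiegelDoubled
open Summit.HodgeConjecture.HodgeConjecture.Cruxes.HLiu418.K2LiuArchSectionPlaceBlock
open Summit.HodgeConjecture.HodgeConjecture.Cruxes.HLiu418 (K2LiuArchOneParameterOrbitDefs.archEmb)
open Summit.HodgeConjecture.HodgeConjecture.Cruxes.HLiu418.K2LiuSwSectionArchOrbit
open Summit.HodgeConjecture.HodgeConjecture.Cruxes.HLiu418.K2LiuWeilSeesawRelabel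
open Summit.HodgeConjecture.HodgeConjecture.Cruxes.HLiu418.K2LiuArchTensorPlaceSec
open Summit.HodgeConjecture.HodgeConjecture.Cruxes.HLiu418.K2LiuArchHermiteGlue
open Summit.HodgeConjecture.HodgeConjecture.Cruxes.HLiu418.K2LiuDoubledWeilRepArchPinned
open Summit.HodgeConjecture.HodgeConjecture.Cruxes.HLiu418.K2LiuArchHermiteDatumStability
open Summit.HodgeConjecture.HodgeConjecture.Cruxes.HLiu418.K2LiuArchSWSpanningDefs

namespace Summit.HodgeConjecture.HodgeConjecture.Cruxes.HLiu418.K2LiuArchHermiteDatum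

variable (L : Type) [Field L] [NumberField L] [IsCMField L]
variable {N M n : ℕ} (e : Fin N × Fin M ≃ Fin n)
  (dV : Fin N → L) (hdV : ∀ i, IsCMField.complexConj L (dV i) = dV i) (hdV0 : ∀ i, dV i ≠ 0)
  (dW : Fin M → L) (hdW : ∀ i, IsCMField.complexConj L (dW i) = dW i) (hdW0 : ∀ i, dW i ≠ 0)
variable {M₂ M' n' : ℕ} (eW : Fin M × Fin M₂ ≃ Fin M') (e' : Fin N × Fin M' ≃ Fin n')
  (dV' : Fin M₂ → L) (hdV' : ∀ k, IsCMField.complexConj L (dV' k) = dV' k) (hdV'0 : ∀ k, dV' k ≠ 0)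

-- the doubled metaplectic carrier of the big datum and the CM sign frames elaborate slowly (as ★ J2c ∕ ★ 3-b step 2)
set_option maxHeartbeats 4000000

/-- finitely many multi-indices of bounded total degree on a finite index type. [cite: Folland1989, §1.7] -/
theorem finite_setOf_degree_le {ι : Type} [Fintype ι] [DecidableEq ι] (D : ℕ) : {γ : ι →₀ ℕ | γ.degree ≤ D}.Finite := by
  refine (Set.finite_range (fun g : ι → Fin (D + 1) => Finsupp.equivFunOnFinite.symm (fun i => (g i : ℕ)))).subset ?_
  intro γ hγ
  refine ⟨fun i => ⟨γ i, Nat.lt_succ_of_le ((Finsupp.le_degree i γ).trans hγ)⟩, ?_⟩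
  ext i
  simp

/-- linear extension over a span: if every generator `x ∈ S` has a partner `x′ ∈ V` with `T f x = U f x′` for all `f`, so does every `a ∈ span S`
(for families of ℂ-linear maps `T f`, `U f`). [cite: HarrisKudlaSweet1996, §1 (1.15)–(1.17)] -/
theorem exists_mem_forall_eq_of_span {M₀ N₀ : Type} [AddCommGroup M₀] [Module ℂ M₀] [AddCommGroup N₀] [Module ℂ N₀] {φ : Type} (S : Set M₀)
    (V : Submodule ℂ M₀) (T U : φ → M₀ →ₗ[ℂ] N₀) (hgen : ∀ x ∈ S, ∃ x' ∈ V, ∀ f, T f x = U f x') :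
    ∀ a ∈ Submodule.span ℂ S, ∃ a' ∈ V, ∀ f, T f a = U f a' := by
  intro a ha
  induction ha using Submodule.span_induction with
  | mem x hx => exact hgen x hx
  | zero => exact ⟨0, V.zero_mem, fun f => by rw [map_zero, map_zero]⟩
  | add a b _ _ iha ihb =>
    obtain ⟨a', ha', hfa⟩ := iha
    obtain ⟨b', hb', hfb⟩ := ihb
    exact ⟨a' + b', V.add_mem ha' hb', fun f => by rw [map_add, map_add, hfa, hfb]⟩
  | smul c a _ iha =>
    obtain ⟨a', ha', hfa⟩ := iha
    exact ⟨c • a', V.smul_mem c ha', fun f => by rw [map_smul, map_smul, hfa]⟩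

include hdW0 in
/-- **THE HERMITE SPAN IS AN ARCH DATUM** (σ15 packaged; see the module docstring).  `hK`: every `ainf` with `archToAdelic ainf ∈ 𝒦.K` lies in the submonoid of
`H(L⁺ ⊗ ℝ)` generated by the one-place elements `placeSec_𝔻 σ h` whose junction Weil operator at `(h,1)` does not raise the Hermite degree.
[cite: Folland1989, §1.7, Prop. (4.39)] [cite: Howe1989, §3] [cite: HarrisKudlaSweet1996, §1 (1.15)–(1.17)] [cite: KonnoKonno2007, §3.3 p. 47] -/
theorem isArchDatum_hermiteSpan {χ : HeckeCharacter L} (hχu : χ.IsUnitary) (hχs : IsSplittingChar L 1 χ)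
    {sB : HA L e' dV hdV (tensorFrame L dW eW dV') (tensorFrame_real L dW hdW eW dV' hdV') →* MpD L e' dV hdV (tensorFrame L dW eW dV') (tensorFrame_real L dW hdW eW dV' hdV')}
    (hsB : IsDoubledWeilRep L e' dV hdV hdV0 (tensorFrame L dW eW dV') (tensorFrame_real L dW hdW eW dV' hdV')
      (tensorFrame_ne_zero L dW eW dV' hdW0 hdV'0) χ sB)
    {t : InfinitePlace L → ℤ} (ht : χ.HasUnitaryArchType t 0) (hodd : ∀ w, Odd (t w))
    (y : ∀ σ : {v : InfinitePlace (Fp L) // v.IsReal}, Fin M₂ → ℝ)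
    (hy : ∀ σ : {v : InfinitePlace (Fp L) // v.IsReal}, ∀ k, (y σ) k ≠ 0)
    (hz : ∀ σ : {v : InfinitePlace (Fp L) // v.IsReal}, ∀ j, signVec (cmPlaceOver L)
        (fun k => Sum.elim (cmGramEntry L e' dV hdV (tensorFrame L dW eW dV') (tensorFrame_real L dW hdW eW dV' hdV'))
          (-cmGramEntry L e' dV hdV (tensorFrame L dW eW dV') (tensorFrame_real L dW hdW eW dV' hdV')) ((LocalSplitting.e₂ n').symm k))
        (imagUnit L) σ j =
      signVec (cmPlaceOver L)
          (fun k => Sum.elim (cmGramEntry L e dV hdV dW hdW) (-cmGramEntry L e dV hdV dW hdW) ((LocalSplitting.e₂ n).symm k)) (imagUnit L) σ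
          ((epsD e eW e').symm j).1 * (y σ) ((epsD e eW e').symm j).2)
    (eP : ∀ σ : {v : InfinitePlace (Fp L) // v.IsReal}, (PosIdx (signVec (cmPlaceOver L)
          (fun k => Sum.elim (cmGramEntry L e dV hdV dW hdW) (-cmGramEntry L e dV hdV dW hdW) ((LocalSplitting.e₂ n).symm k)) (imagUnit L) σ) × PosIdx (y σ)) ⊕
        (NegIdx (signVec (cmPlaceOver L)
          (fun k => Sum.elim (cmGramEntry L e dV hdV dW hdW) (-cmGramEntry L e dV hdV dW hdW) ((LocalSplitting.e₂ n).symm k)) (imagUnit L) σ) × NegIdx (y σ)) ≃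
      PosIdx (signVec (cmPlaceOver L)
        (fun k => Sum.elim (cmGramEntry L e' dV hdV (tensorFrame L dW eW dV') (tensorFrame_real L dW hdW eW dV' hdV'))
          (-cmGramEntry L e' dV hdV (tensorFrame L dW eW dV') (tensorFrame_real L dW hdW eW dV' hdV')) ((LocalSplitting.e₂ n').symm k))
        (imagUnit L) σ))
    (eQ : ∀ σ : {v : InfinitePlace (Fp L) // v.IsReal}, (PosIdx (signVec (cmPlaceOver L)
          (fun k => Sum.elim (cmGramEntry L e dV hdV dW hdW) (-cmGramEntry L e dV hdV dW hdW) ((LocalSplitting.e₂ n).symm k)) (imagUnit L) σ) × NegIdx (y σ)) ⊕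
        (NegIdx (signVec (cmPlaceOver L)
          (fun k => Sum.elim (cmGramEntry L e dV hdV dW hdW) (-cmGramEntry L e dV hdV dW hdW) ((LocalSplitting.e₂ n).symm k)) (imagUnit L) σ) × PosIdx (y σ)) ≃
      NegIdx (signVec (cmPlaceOver L)
        (fun k => Sum.elim (cmGramEntry L e' dV hdV (tensorFrame L dW eW dV') (tensorFrame_real L dW hdW eW dV' hdV'))
          (-cmGramEntry L e' dV hdV (tensorFrame L dW eW dV') (tensorFrame_real L dW hdW eW dV' hdV')) ((LocalSplitting.e₂ n').symm k))
        (imagUnit L) σ))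
    (hE : ∀ σ : {v : InfinitePlace (Fp L) // v.IsReal}, ∀ i, (dpEquiv _ _ _ _).symm (((eP σ).sumCongr (eQ σ)).symm i) =
      (signSplit (signVec (cmPlaceOver L)
          (fun k => Sum.elim (cmGramEntry L e dV hdV dW hdW) (-cmGramEntry L e dV hdV dW hdW) ((LocalSplitting.e₂ n).symm k)) (imagUnit L) σ)
        ((epsD e eW e').symm ((signSplit (signVec (cmPlaceOver L)
          (fun k => Sum.elim (cmGramEntry L e' dV hdV (tensorFrame L dW eW dV') (tensorFrame_real L dW hdW eW dV' hdV'))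
            (-cmGramEntry L e' dV hdV (tensorFrame L dW eW dV') (tensorFrame_real L dW hdW eW dV' hdV')) ((LocalSplitting.e₂ n').symm k))
          (imagUnit L) σ)).symm i)).1,
       signSplit (y σ) ((epsD e eW e').symm ((signSplit (signVec (cmPlaceOver L)
          (fun k => Sum.elim (cmGramEntry L e' dV hdV (tensorFrame L dW eW dV') (tensorFrame_real L dW hdW eW dV' hdV'))
            (-cmGramEntry L e' dV hdV (tensorFrame L dW eW dV') (tensorFrame_real L dW hdW eW dV' hdV')) ((LocalSplitting.e₂ n').symm k))
          (imagUnit L) σ)).symm i)).2))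
    (𝒦 : IwasawaDatum L e dV hdV dW hdW)
    (hK : ∀ ainf : UnitaryGroup.arch (Fp L) L (IsCMField.complexConj L) (n + n) (hermD L e dV hdV dW hdW),
      (UnitaryGroup.archToAdelic (Fp L) L (IsCMField.complexConj L) (n + n) (hermD L e dV hdV dW hdW) ainf : HA L e dV hdV dW hdW) ∈ 𝒦.K →
      ainf ∈ Submonoid.closure {k : UnitaryGroup.arch (Fp L) L (IsCMField.complexConj L) (n + n) (hermD L e dV hdV dW hdW) |
        ∃ (σ : {v : InfinitePlace (Fp L) // v.IsReal}) (h : UForm (PosIdx (signVec (cmPlaceOver L) (fun k => Sum.elim (cmGramEntry L e dV hdV dW hdW) (-cmGramEntry L e dV hdV dW hdW) ((LocalSplitting.e₂ n).symm k)) (imagUnit L) σ)) (NegIdx (signVec (cmPlaceOver L) (fun k => Sum.elim (cmGramEntry L e dV hdV dW hdW) (-cmGramEntry L e dV hdV dW hdW) ((LocalSplitting.e₂ n).symm k)) (imagUnit L) σ))),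
          (∀ β₁ : DPIdx (PosIdx (signVec (cmPlaceOver L) (fun k => Sum.elim (cmGramEntry L e dV hdV dW hdW) (-cmGramEntry L e dV hdV dW hdW) ((LocalSplitting.e₂ n).symm k)) (imagUnit L) σ)) (NegIdx (signVec (cmPlaceOver L) (fun k => Sum.elim (cmGramEntry L e dV hdV dW hdW) (-cmGramEntry L e dV hdV dW hdW) ((LocalSplitting.e₂ n).symm k)) (imagUnit L) σ)) (PosIdx (y σ)) (NegIdx (y σ)) →₀ ℕ,
            (weilRep (α := ((PosIdx (signVec (cmPlaceOver L) (fun k => Sum.elim (cmGramEntry L e dV hdV dW hdW) (-cmGramEntry L e dV hdV dW hdW) ((LocalSplitting.e₂ n).symm k)) (imagUnit L) σ)) × (PosIdx (y σ))) ⊕ ((NegIdx (signVec (cmPlaceOver L) (fun k => Sum.elim (cmGramEntry L e dV hdV dW hdW) (-cmGramEntry L e dV hdV dW hdW) ((LocalSplitting.e₂ n).symm k)) (imagUnit L) σ)) × (NegIdx (y σ)))) (β := ((PosIdx (signVec (cmPlaceOver L) (fun k => Sum.elim (cmGramEntry L e dV hdV dW hdW) (-cmGramEntry L e dV hdV dW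 hdW) ((LocalSplitting.e₂ n).symm k)) (imagUnit L) σ)) × (NegIdx (y σ))) ⊕ ((NegIdx (signVec (cmPlaceOver L) (fun k => Sum.elim (cmGramEntry L e dV hdV dW hdW) (-cmGramEntry L e dV hdV dW hdW) ((LocalSplitting.e₂ n).symm k)) (imagUnit L) σ)) × (PosIdx (y σ))))).comp (toBig (PosIdx (signVec (cmPlaceOver L) (fun k => Sum.elim (cmGramEntry L e dV hdV dW hdW) (-cmGramEntry L e dV hdV dW hdW) ((LocalSplitting.e₂ n).symm k)) (imagUnit L) σ)) (NegIdx (signVec (cmPlaceOver L) (fun k => Sum.elim (cmGramEntry L e dV hdV dW hdW) (-cmGramEntry L e dV hdV dW hdW) ((LocalSplitting.e₂ n).symm k)) (imagUnit L) σ)) (PosIdx (y σ)) (NegIdx (y σ))) ((h, (1 : UForm (PosIdx (y σ)) (NegIdx (y σ)))) : Ginf (PosIdx (signVec (cmPlaceOver L) (fun k => Sum.elim (cmGramEntry L e dV hdV dW hdW) (-cmGramEntry L e dV hdV dW hdW) ((LocalSplitting.e₂ n).symm k)) (imagUnit L) σ)) (NegIdx (signVec (cmPlaceOver L) (fun k =>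 Sum.elim (cmGramEntry L e dV hdV dW hdW) (-cmGramEntry L e dV hdV dW hdW) ((LocalSplitting.e₂ n).symm k)) (imagUnit L) σ)) (PosIdx (y σ)) (NegIdx (y σ))) (hermitePi β₁) ∈
              Submodule.span ℂ {x : 𝓢((DPIdx (PosIdx (signVec (cmPlaceOver L) (fun k => Sum.elim (cmGramEntry L e dV hdV dW hdW) (-cmGramEntry L e dV hdV dW hdW) ((LocalSplitting.e₂ n).symm k)) (imagUnit L) σ)) (NegIdx (signVec (cmPlaceOver L) (fun k => Sum.elim (cmGramEntry L e dV hdV dW hdW) (-cmGramEntry L e dV hdV dW hdW) ((LocalSplitting.e₂ n).symm k)) (imagUnit L) σ)) (PosIdx (y σ)) (NegIdx (y σ)) → ℝ), ℂ) | ∃ γ : DPIdx (PosIdx (signVec (cmPlaceOver L) (fun k => Sum.elim (cmGramEntry L e dV hdV dW hdW) (-cmGramEntry L e dV hdV dW hdW) ((LocalSplitting.e₂ n).symm k)) (imagUnit L) σ)) (NegIdx (signVec (cmPlaceOver L) (fun k => Sum.elim (cmGramEntry L e dV hdV dW hdW) (-cmGramEntry L e dV hdV dW hdW) ((LocalSplitting.e₂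 n).symm k)) (imagUnit L) σ)) (PosIdx (y σ)) (NegIdx (y σ)) →₀ ℕ, γ.degree ≤ β₁.degree ∧ hermitePi γ = x}) ∧
          k = (placeSec L (IsCMField.complexConj L) (n + n) (IsCMField.complexConj_ne_one L) (cmPlaceOver L) (cmPlaceOver_smul L) _
          (gramD_gram_realDiagonal_entry_ne_zero L e dV hdV dW hdW hdV0 hdW0) (complexConj_imagUnit L) (imagUnit_ne_zero L) σ
          (cmPlaceOver_comap L) (gramD_eq_diagonal_cm L e dV hdV dW hdW) (J := hermD L e dV hdV dW hdW) rfl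
          (complexConj_smul_infinitePlace L) h)})
    (D : ℕ) :
    IsArchDatum L e dV hdV dW hdW eW e' dV' hdV' sB 𝒦 (Submodule.span ℂ {x : 𝓢((Fin (n' + n') → mixedSpace (Fp L)), ℂ) | ∃ γ : (Fin (n' + n') × {v : InfinitePlace (Fp L) // v.IsReal}) →₀ ℕ, γ.degree ≤ D ∧ follandHermite (GRConstruction.frameD L e' dV hdV hdV0 (tensorFrame L dW eW dV') (tensorFrame_real L dW hdW eW dV' hdV') (tensorFrame_ne_zero L dW eW dV' hdW0 hdV'0)) γ = x}) := by
  unfold IsArchDatum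
  refine And.intro ?_ fun ainf hainf => ?_
  · -- finitely many Hermite vectors of degree `≤ D`
    have hfin : {x : 𝓢((Fin (n' + n') → mixedSpace (Fp L)), ℂ) |
        ∃ γ : (Fin (n' + n') × {v : InfinitePlace (Fp L) // v.IsReal}) →₀ ℕ, γ.degree ≤ D ∧ follandHermite (GRConstruction.frameD L e' dV hdV hdV0 (tensorFrame L dW eW dV') (tensorFrame_real L dW hdW eW dV' hdV') (tensorFrame_ne_zero L dW eW dV' hdW0 hdV'0)) γ = x}.Finite := by
      refine ((finite_setOf_degree_le D).image fun γ => follandHermite (GRConstruction.frameD L e' dV hdV hdV0 (tensorFrame L dW eW dV') (tensorFrame_real L dW hdW eW dV' hdV') (tensorFrame_ne_zero L dW eW dV' hdW0 hdV'0)) γ).subset ?_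
      rintro x ⟨γ, hγ, rfl⟩
      exact ⟨γ, hγ, rfl⟩
    exact FiniteDimensional.span_of_finite ℂ hfin
  · -- stability: induction over the generated submonoid; on generators, linear extension of ★ 3-b step 2 over the span
    -- the `a`-slot maps `a ↦ Ω (E(a ⊗ f))` and `a ↦ E(a ⊗ f)` as linear maps
    -- the composite homomorphism `k ↦ ω(sB((k) ⊗ 1))` of `H(L⁺ ⊗ ℝ)` (so that `map_one`∕`map_mul` never unfold the carrier types)
    let Rk : UnitaryGroup.arch (Fp L) L (IsCMField.complexConj L) (n + n) (hermD L e dV hdV dW hdW) →*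
        Module.End ℂ (piSchwartzBruhat (Fp L) (Fin (n' + n'))) :=
      (adelicMpCont.omega (Fp L) (Fin (n' + n')) (gramDA L e' dV hdV (tensorFrame L dW eW dV') (tensorFrame_real L dW hdW eW dV' hdV'))).comp
        (sB.comp ((tensorEmb L e dV hdV dW hdW eW e' dV' hdV').comp (UnitaryGroup.archToAdelic (Fp L) L (IsCMField.complexConj L) (n + n) (hermD L e dV hdV dW hdW))))
    have hRk : ∀ k v, Rk k v =
        adelicMpCont.omega (Fp L) (Fin (n' + n')) (gramDA L e' dV hdV (tensorFrame L dW eW dV') (tensorFrame_real L dW hdW eW dV' hdV'))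
          (sB (tensorEmb L e dV hdV dW hdW eW e' dV' hdV'
            (UnitaryGroup.archToAdelic (Fp L) L (IsCMField.complexConj L) (n + n) (hermD L e dV hdV dW hdW) k : HA L e dV hdV dW hdW))) v :=
      fun k v => rfl
    have key : ∀ k ∈ Submonoid.closure {k : UnitaryGroup.arch (Fp L) L (IsCMField.complexConj L) (n + n) (hermD L e dV hdV dW hdW) |
        ∃ (σ : {v : InfinitePlace (Fp L) // v.IsReal}) (h : UForm (PosIdx (signVec (cmPlaceOver L) (fun k => Sum.elim (cmGramEntry L e dV hdV dW hdW) (-cmGramEntry L e dV hdV dW hdW) ((LocalSplitting.e₂ n).symm k)) (imagUnit L) σ)) (NegIdx (signVec (cmPlaceOver L) (fun k => Sum.elim (cmGramEntry L e dV hdV dW hdW) (-cmGramEntry L e dV hdV dW hdW) ((LocalSplitting.e₂ n).symm k)) (imagUnit L) σ))),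
          (∀ β₁ : DPIdx (PosIdx (signVec (cmPlaceOver L) (fun k => Sum.elim (cmGramEntry L e dV hdV dW hdW) (-cmGramEntry L e dV hdV dW hdW) ((LocalSplitting.e₂ n).symm k)) (imagUnit L) σ)) (NegIdx (signVec (cmPlaceOver L) (fun k => Sum.elim (cmGramEntry L e dV hdV dW hdW) (-cmGramEntry L e dV hdV dW hdW) ((LocalSplitting.e₂ n).symm k)) (imagUnit L) σ)) (PosIdx (y σ)) (NegIdx (y σ)) →₀ ℕ,
            (weilRep (α := ((PosIdx (signVec (cmPlaceOver L) (fun k => Sum.elim (cmGramEntry L e dV hdV dW hdW) (-cmGramEntry L e dV hdV dW hdW) ((LocalSplitting.e₂ n).symm k)) (imagUnit L) σ)) × (PosIdx (y σ))) ⊕ ((NegIdx (signVec (cmPlaceOver L) (fun k => Sum.elim (cmGramEntry L e dV hdV dW hdW) (-cmGramEntry L e dV hdV dW hdW) ((LocalSplitting.e₂ n).symm k)) (imagUnit L) σ)) × (NegIdx (y σ)))) (β := ((PosIdx (signVec (cmPlaceOver L) (fun k => Sum.elim (cmGramEntry L e dV hdV dW hdW) (-cmGramEntry L e dV hdV dW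 hdW) ((LocalSplitting.e₂ n).symm k)) (imagUnit L) σ)) × (NegIdx (y σ))) ⊕ ((NegIdx (signVec (cmPlaceOver L) (fun k => Sum.elim (cmGramEntry L e dV hdV dW hdW) (-cmGramEntry L e dV hdV dW hdW) ((LocalSplitting.e₂ n).symm k)) (imagUnit L) σ)) × (PosIdx (y σ))))).comp (toBig (PosIdx (signVec (cmPlaceOver L) (fun k => Sum.elim (cmGramEntry L e dV hdV dW hdW) (-cmGramEntry L e dV hdV dW hdW) ((LocalSplitting.e₂ n).symm k)) (imagUnit L) σ)) (NegIdx (signVec (cmPlaceOver L) (fun k => Sum.elim (cmGramEntry L e dV hdV dW hdW) (-cmGramEntry L e dV hdV dW hdW) ((LocalSplitting.e₂ n).symm k)) (imagUnit L) σ)) (PosIdx (y σ)) (NegIdx (y σ))) ((h, (1 : UForm (PosIdx (y σ)) (NegIdx (y σ)))) : Ginf (PosIdx (signVec (cmPlaceOver L) (fun k => Sum.elim (cmGramEntry L e dV hdV dW hdW) (-cmGramEntry L e dV hdV dW hdW) ((LocalSplitting.e₂ n).symm k)) (imagUnit L) σ)) (NegIdx (signVec (cmPlaceOver L) (fun k =>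 Sum.elim (cmGramEntry L e dV hdV dW hdW) (-cmGramEntry L e dV hdV dW hdW) ((LocalSplitting.e₂ n).symm k)) (imagUnit L) σ)) (PosIdx (y σ)) (NegIdx (y σ))) (hermitePi β₁) ∈
              Submodule.span ℂ {x : 𝓢((DPIdx (PosIdx (signVec (cmPlaceOver L) (fun k => Sum.elim (cmGramEntry L e dV hdV dW hdW) (-cmGramEntry L e dV hdV dW hdW) ((LocalSplitting.e₂ n).symm k)) (imagUnit L) σ)) (NegIdx (signVec (cmPlaceOver L) (fun k => Sum.elim (cmGramEntry L e dV hdV dW hdW) (-cmGramEntry L e dV hdV dW hdW) ((LocalSplitting.e₂ n).symm k)) (imagUnit L) σ)) (PosIdx (y σ)) (NegIdx (y σ)) → ℝ), ℂ) | ∃ γ : DPIdx (PosIdx (signVec (cmPlaceOver L) (fun k => Sum.elim (cmGramEntry L e dV hdV dW hdW) (-cmGramEntry L e dV hdV dW hdW) ((LocalSplitting.e₂ n).symm k)) (imagUnit L) σ)) (NegIdx (signVec (cmPlaceOver L) (fun k => Sum.elim (cmGramEntry L e dV hdV dW hdW) (-cmGramEntry L e dV hdV dW hdW) ((LocalSplitting.e₂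 n).symm k)) (imagUnit L) σ)) (PosIdx (y σ)) (NegIdx (y σ)) →₀ ℕ, γ.degree ≤ β₁.degree ∧ hermitePi γ = x}) ∧
          k = (placeSec L (IsCMField.complexConj L) (n + n) (IsCMField.complexConj_ne_one L) (cmPlaceOver L) (cmPlaceOver_smul L) _
          (gramD_gram_realDiagonal_entry_ne_zero L e dV hdV dW hdW hdV0 hdW0) (complexConj_imagUnit L) (imagUnit_ne_zero L) σ
          (cmPlaceOver_comap L) (gramD_eq_diagonal_cm L e dV hdV dW hdW) (J := hermD L e dV hdV dW hdW) rfl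
          (complexConj_smul_infinitePlace L) h)},
        ∀ a ∈ (Submodule.span ℂ {x : 𝓢((Fin (n' + n') → mixedSpace (Fp L)), ℂ) | ∃ γ : (Fin (n' + n') × {v : InfinitePlace (Fp L) // v.IsReal}) →₀ ℕ, γ.degree ≤ D ∧ follandHermite (GRConstruction.frameD L e' dV hdV hdV0 (tensorFrame L dW eW dV') (tensorFrame_real L dW hdW eW dV' hdV') (tensorFrame_ne_zero L dW eW dV' hdW0 hdV'0)) γ = x}), ∃ a' ∈ (Submodule.span ℂ {x : 𝓢((Fin (n' + n') → mixedSpace (Fp L)), ℂ) | ∃ γ : (Fin (n' + n') × {v : InfinitePlace (Fp L) // v.IsReal}) →₀ ℕ, γ.degree ≤ D ∧ follandHermite (GRConstruction.frameD L e' dV hdV hdV0 (tensorFrame L dW eW dV') (tensorFrame_real L dW hdW eW dV' hdV') (tensorFrame_ne_zero L dW eW dV' hdW0 hdV'0)) γ = x}), ∀ f : FinSB (Fp L) (Fin (n' + n')), Rk k (piSchwartzBruhatEquiv (Fp L) (Fin (n' + n')) (a ⊗ₜ[ℂ] f)) = piSchwartzBruhatEquiv (Fp L) (Fin (n' + n'))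 (a' ⊗ₜ[ℂ] f) := by
      intro k hk
      induction hk using Submonoid.closure_induction with
      | mem k hk =>
        obtain ⟨σ, h, hFock, rfl⟩ := hk
        intro a ha
        -- linear extension of ★ 3-b step 2 over the span (the `a`-slot maps as linear maps, read back by `simpa`)
        obtain ⟨a', ha', hfa⟩ := exists_mem_forall_eq_of_span
          {x : 𝓢((Fin (n' + n') → mixedSpace (Fp L)), ℂ) | ∃ γ : (Fin (n' + n') × {v : InfinitePlace (Fp L) // v.IsReal}) →₀ ℕ, γ.degree ≤ D ∧ follandHermite (GRConstruction.frameD L e' dV hdV hdV0 (tensorFrame L dW eW dV') (tensorFrame_real L dW hdW eW dV' hdV') (tensorFrame_ne_zero L dW eW dV' hdW0 hdV'0)) γ = x}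
          (Submodule.span ℂ {x : 𝓢((Fin (n' + n') → mixedSpace (Fp L)), ℂ) | ∃ γ : (Fin (n' + n') × {v : InfinitePlace (Fp L) // v.IsReal}) →₀ ℕ, γ.degree ≤ D ∧ follandHermite (GRConstruction.frameD L e' dV hdV hdV0 (tensorFrame L dW eW dV') (tensorFrame_real L dW hdW eW dV' hdV') (tensorFrame_ne_zero L dW eW dV' hdW0 hdV'0)) γ = x})
          (fun f : FinSB (Fp L) (Fin (n' + n')) => (Rk ((placeSec L (IsCMField.complexConj L) (n + n) (IsCMField.complexConj_ne_one L) (cmPlaceOver L) (cmPlaceOver_smul L) _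
          (gramD_gram_realDiagonal_entry_ne_zero L e dV hdV dW hdW hdV0 hdW0) (complexConj_imagUnit L) (imagUnit_ne_zero L) σ
          (cmPlaceOver_comap L) (gramD_eq_diagonal_cm L e dV hdV dW hdW) (J := hermD L e dV hdV dW hdW) rfl
          (complexConj_smul_infinitePlace L) h))).comp ((piSchwartzBruhatEquiv (Fp L) (Fin (n' + n'))).toLinearMap.comp ((TensorProduct.mk ℂ (𝓢((Fin (n' + n') → mixedSpace (Fp L)), ℂ)) (FinSB (Fp L) (Fin (n' + n')))).flip f)))
          (fun f : FinSB (Fp L) (Fin (n' + n')) => (piSchwartzBruhatEquiv (Fp L) (Fin (n' + n'))).toLinearMap.comp ((TensorProduct.mk ℂ (𝓢((Fin (n' + n') → mixedSpace (Fp L)), ℂ)) (FinSB (Fp L) (Fin (n' + n')))).flip f))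
          (fun x hx => by
            obtain ⟨β, hβ, rfl⟩ := hx
            obtain ⟨Φ', hΦ', hΦ⟩ := exists_mem_span_omega_tensorEmb_placeSec L e dV hdV hdV0 dW hdW hdW0 eW e' dV' hdV' hdV'0 σ hχu hχs hsB
              ht hodd h (y σ) (hy σ) (hz σ) (eP σ) (eQ σ) (hE σ) hFock D β hβ
            exact ⟨Φ', hΦ', fun f => by
              simpa only [LinearMap.comp_apply, LinearMap.flip_apply, TensorProduct.mk_apply, LinearEquiv.coe_toLinearMap,
                LinearEquiv.coe_coe, hRk] using hΦ f⟩)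
          a ha
        exact ⟨a', ha', fun f => by
          simpa only [LinearMap.comp_apply, LinearMap.flip_apply, TensorProduct.mk_apply, LinearEquiv.coe_toLinearMap, LinearEquiv.coe_coe]
            using hfa f⟩
      | one =>
        intro a ha
        exact ⟨a, ha, fun f => by rw [map_one, Module.End.one_apply]⟩
      | mul k₁ k₂ _ _ ih₁ ih₂ =>
        intro a ha
        obtain ⟨a₂, ha₂, h₂⟩ := ih₂ a ha
        obtain ⟨a₁, ha₁, h₁⟩ := ih₁ a₂ ha₂
        exact ⟨a₁, ha₁, fun f => by rw [map_mul, Module.End.mul_apply, h₂ f, h₁ f]⟩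
    intro a ha
    obtain ⟨a', ha', hfa⟩ := key ainf (hK ainf hainf) a ha
    exact ⟨a', ha', fun f => by rw [← hRk]; exact hfa f⟩

end Summit.HodgeConjecture.HodgeConjecture.Cruxes.HLiu418.K2LiuArchHermiteDatum

end
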